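import Mathlib
import Summits.ValiantsHypothesis.ValiantsHypothesis.Theorems.BinomialElusiveBinomialCandidateGeneric
import Summits.ValiantsHypothesis.ValiantsHypothesis.Theorems.BinomialElusiveBinomialCandidateInfinityStepTwo
import Summits.ValiantsHypothesis.ValiantsHypothesis.Theorems.BinomialElusiveBinomialCandidateInfinityStepTwoImproper

/-!
# Crux `BinomialElusive.BinomialCandidate` (stmt-ValiantsHypothesis-7392), line `registered` —
# the NEAR-RULED NORMAL FORM of every swallowing quadratic map (structure at infinity, v4)

Second consequence of the wave-1 stubs at the place over `x = ∞` (`stub_infinityGlue`,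
`stub_infinityCommonZero`, `stub_infinityStepTwo`, `stub_infinityStepTwoImproper`): if a quadratic
map `Γ : ℂ^s → ℂ^m` contains in its image a binomial curve `x ↦ (x^{a_i} + x^{b_i})_i` with
`a_i < b_i`, `b` injective and the mild growth condition "for every `τ` some `i ≠ τ` has
`b_τ < 2 b_i`", then there is a nonzero `z ∈ ℂ^s` (the direction of the deepest pole of a Laurent
solution at infinity) such that EITHER

* (improper branch) every quadratic part `B_i = homogeneousComponent 2 (Γ i)` vanishes at `z`,
  and moreover either a second direction `z' ∉ ℂz` is killed by the polar forms
  `Σ_j z'_j ∂_jB_i(z)` for all but at most one `i`, or some point `w` has `dΓ_i(w)·z = 0` for all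
  but at most one `i` (with `B_i(z) = 0` this says: the affine line `w + ℂz` is contracted by all
  coordinates of `Γ` but one);
* (proper branch) all quadratic parts but one, `B_τ`, vanish at `z`, and a second direction
  `z' ∉ ℂz` is killed by the polar forms `Σ_j z'_j ∂_jB_i(z)` for all `i` off two indices.

In coordinates with `z = e₁` the first conclusion reads `Γ_i = y₁ A_i(y') + G_i(y')` for all `i`
(resp. all `i ≠ τ`): the image of `Γ` is swept by the lines `y' = const` — "near-ruled".

* `NearRuled.structure_of_range_subset` — general binomial curves;
* `nearRuled_of_binomialCandidate_range` — the instance for the route's E-curve, `m ≥ 128`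
  (`stub_expoGrowth` supplies monotonicity and the growth condition).

No new analysis: bookkeeping over the four landed stubs.
-/

-- layout Summits/ValiantsHypothesis/ValiantsHypothesis forces the duplicated namespace component
set_option linter.dupNamespace false

namespace Summit.ValiantsHypothesis.ValiantsHypothesis.Theorems.BinomialCandidateStubs

open scoped BigOperators

namespace NearRuled

/-- **The structure at infinity of a swallowing quadratic map** (general binomial curves). -/
theorem structure_of_range_subset {m s : ℕ} (hm : 0 < m) (a b : Fin m → ℕ)
    (hab : ∀ i, a i < b i) (hb : Function.Injective b)
    (hdbl : ∀ τ : Fin m, ∃ i, i ≠ τ ∧ b τ < 2 * b i)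
    (Γ : Fin m → MvPolynomial (Fin s) ℂ) (hΓ : ∀ i, (Γ i).totalDegree ≤ 2)
    (hsub : Set.range (fun x : ℂ => fun i : Fin m => x ^ a i + x ^ b i) ⊆
      Set.range (fun y : Fin s → ℂ => fun i : Fin m => MvPolynomial.eval y (Γ i))) :
    ∃ z : Fin s → ℂ, z ≠ 0 ∧
      (((∀ i, MvPolynomial.eval z (MvPolynomial.homogeneousComponent 2 (Γ i)) = 0) ∧
        ((∃ z' : Fin s → ℂ, (∀ c : ℂ, z' ≠ c • z) ∧ ∃ i₁ : Fin m, ∀ i, i ≠ i₁ →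
            ∑ j, z' j * MvPolynomial.eval z
              (MvPolynomial.pderiv j (MvPolynomial.homogeneousComponent 2 (Γ i))) = 0) ∨
          (∃ w : Fin s → ℂ, ∃ i₁ : Fin m, ∀ i, i ≠ i₁ →
            ∑ j, z j * MvPolynomial.eval w (MvPolynomial.pderiv j (Γ i)) = 0))) ∨
      (∃ τ : Fin m, (∀ i, i ≠ τ → MvPolynomial.eval z (MvPolynomial.homogeneousComponent 2 (Γ i)) = 0) ∧
        ∃ z' : Fin s → ℂ, (∀ c : ℂ, z' ≠ c • z) ∧ ∃ i₁ : Fin m, ∀ i, i ≠ τ → i ≠ i₁ →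
          ∑ j, z' j * MvPolynomial.eval z
            (MvPolynomial.pderiv j (MvPolynomial.homogeneousComponent 2 (Γ i))) = 0)) := by
  obtain ⟨N, p, hN, hp⟩ := stub_infinityGlue m s a b Γ hm hΓ hsub
  obtain ⟨μ, hμ, hpμ, hz, hB⟩ := stub_infinityCommonZero m s a b Γ N p hm hΓ hN hab hp
  refine ⟨fun j => (p j).coeff μ, hz, ?_⟩
  by_cases hτ : ∃ τ : Fin m, 2 * μ = -((N * b τ : ℕ) : ℤ)
  · obtain ⟨τ, hτ⟩ := hτ
    have hoff : ∀ i, i ≠ τ →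
        MvPolynomial.eval (fun j => (p j).coeff μ) (MvPolynomial.homogeneousComponent 2 (Γ i)) = 0 := by
      intro i hi
      rcases (hB i).2 with h | h
      · exact h
      · exfalso
        refine hi (hb (Nat.eq_of_mul_eq_mul_left hN ?_))
        have h1 : ((N * b i : ℕ) : ℤ) = ((N * b τ : ℕ) : ℤ) := by linarith
        exact_mod_cast h1
    exact Or.inr ⟨τ, hoff,
      stub_infinityStepTwo m s a b Γ N p μ τ hΓ hN hab hb hp hμ hpμ hz hτ hoff (hdbl τ)⟩
  · push Not at hτ
    have h0 : ∀ i,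
        MvPolynomial.eval (fun j => (p j).coeff μ) (MvPolynomial.homogeneousComponent 2 (Γ i)) = 0 :=
      fun i => ((hB i).2).resolve_right (hτ i)
    exact Or.inl ⟨h0, stub_infinityStepTwoImproper m s a b Γ N p μ hm hΓ hN hab hb hp hμ hpμ hz h0⟩

end NearRuled

open Summit.ValiantsHypothesis.ValiantsHypothesis.Theorems.BinomialElusiveRazTransfer (expo)

/-- **Near-ruled normal form of every swallower of the E-curve** (`m ≥ 128`): if a quadratic
`Γ : ℂ^{m-1} → ℂ^m` contains the route's curve `x ↦ (x^{E(2i+1)} + x^{E(2i+2)})_i` in its image,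
then some nonzero `z` satisfies the structure at infinity (improper branch or proper branch, as in
`NearRuled.structure_of_range_subset`).  Exponents spelled out as in the route decl. -/
theorem nearRuled_of_binomialCandidate_range :
    ∀ m ≥ 128, ∀ Γ : Fin m → MvPolynomial (Fin (m - 1)) ℂ, (∀ i, (Γ i).totalDegree ≤ 2) →
      Set.range (fun x : ℂ => fun i : Fin m =>
          x ^ (∑ k ∈ Finset.range (Nat.log 2 m ^ 2 + 1),
            ((2 * (i : ℕ) + 1) * (2 * m + 2) ^ (Nat.log 2 m ^ 2 + 1)) ^ k) +
          x ^ (∑ k ∈ Finset.range (Nat.log 2 m ^ 2 + 1),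
            ((2 * (i : ℕ) + 2) * (2 * m + 2) ^ (Nat.log 2 m ^ 2 + 1)) ^ k)) ⊆
        Set.range (fun y : Fin (m - 1) → ℂ => fun i : Fin m => MvPolynomial.eval y (Γ i)) →
      ∃ z : Fin (m - 1) → ℂ, z ≠ 0 ∧
        (((∀ i, MvPolynomial.eval z (MvPolynomial.homogeneousComponent 2 (Γ i)) = 0) ∧
          ((∃ z' : Fin (m - 1) → ℂ, (∀ c : ℂ, z' ≠ c • z) ∧ ∃ i₁ : Fin m, ∀ i, i ≠ i₁ →
              ∑ j, z' j * MvPolynomial.eval z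
                (MvPolynomial.pderiv j (MvPolynomial.homogeneousComponent 2 (Γ i))) = 0) ∨
            (∃ w : Fin (m - 1) → ℂ, ∃ i₁ : Fin m, ∀ i, i ≠ i₁ →
              ∑ j, z j * MvPolynomial.eval w (MvPolynomial.pderiv j (Γ i)) = 0))) ∨
        (∃ τ : Fin m, (∀ i, i ≠ τ → MvPolynomial.eval z (MvPolynomial.homogeneousComponent 2 (Γ i)) = 0) ∧
          ∃ z' : Fin (m - 1) → ℂ, (∀ c : ℂ, z' ≠ c • z) ∧ ∃ i₁ : Fin m, ∀ i, i ≠ τ → i ≠ i₁ →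
            ∑ j, z' j * MvPolynomial.eval z
              (MvPolynomial.pderiv j (MvPolynomial.homogeneousComponent 2 (Γ i))) = 0)) := by
  intro m hm Γ hΓ hsub
  -- `stub_expoGrowth` is stated with an abstract witness `m₀`; we re-derive the two facts we need at
  -- `m ≥ 128` from its helpers (`ExpoGrowth.geom_sum_lt_of_lt`, `ExpoGrowth.geom_sum_lt_two_mul`).
  have hL := (ExpoGrowth.log_sq_bounds m hm).2
  have hmono : StrictMono (expo m) := expo_strictMono (by omega)
  have hdbl : ∀ τ : Fin m, ∃ i : Fin m, i ≠ τ ∧ expo m (2 * (τ : ℕ) + 2) < 2 * expo m (2 * (i : ℕ) + 2) := by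
    intro τ
    by_cases hτ : (τ : ℕ) + 1 < m
    · refine ⟨⟨m - 1, by omega⟩, fun h => by simp [Fin.ext_iff] at h; omega, ?_⟩
      have h1 : expo m (2 * (τ : ℕ) + 2) < expo m (2 * (m - 1) + 2) := hmono (by omega)
      have h2 : expo m (2 * (m - 1) + 2) ≤ 2 * expo m (2 * (m - 1) + 2) := by omega
      exact lt_of_lt_of_le h1 (by simpa using h2)
    · have hτm : (τ : ℕ) = m - 1 := by omega
      refine ⟨⟨m - 2, by omega⟩, fun h => by simp [Fin.ext_iff] at h; omega, ?_⟩
      have key := ExpoGrowth.geom_sum_lt_two_mul ((2 * m + 2) ^ (Nat.log 2 m ^ 2 + 1))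
        (Nat.log 2 m ^ 2) (m - 1) (by omega)
      have e1 : 2 * (τ : ℕ) + 2 = 2 * (m - 1) + 2 := by omega
      have e2 : 2 * (m - 2) + 2 = 2 * (m - 1) := by omega
      unfold expo
      rw [e1]
      simpa [e2] using key
  exact NearRuled.structure_of_range_subset (by omega) (fun i : Fin m => expo m (2 * (i : ℕ) + 1))
    (fun i : Fin m => expo m (2 * (i : ℕ) + 2)) (fun i => hmono (by omega))
    (fun i j hij => Fin.ext (by have := hmono.injective hij; omega)) hdbl Γ hΓ hsub

end Summit.ValiantsHypothesis.ValiantsHypothesis.Theorems.BinomialCandidateStubs
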